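import Summits.AtomisticToContinuum.Crystallization.Theorems.PhononSlackCertificatesNearFieldConvexitySegmentSecondVariation
import Summits.AtomisticToContinuum.Crystallization.Theorems.CoarseGrains.Negative.PredicateAPI
import HarnessLib

/-!
# Stub `stub_hullZeroMeanStress` of line `census-liouville`, crux `AlphabetGoodHullElement`
# (route `DisclinationRation`, item stmt-AtomisticToContinuum-15798) — I: pair calculus

Helper file (pair level) for the zero-mean-stress stub: along the affine path `t ↦ u + t A u`
of one bond vector `u` (`‖u‖ ≥ δ`, `|t| ‖A‖ ≤ 1/2`, so `‖u + tAu‖ ≥ ‖u‖/2`), the Lennard-Jones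
pair energy `φ_u(t) = V(‖u + tAu‖)` has `φ_u′(0) = V′(‖u‖)/‖u‖ · ⟪u, A u⟫` and
`|φ_u″| ≤ 2⁸ (14 (δ/2)⁻⁶ + 8) ‖A‖² ‖u‖⁻⁶` (second derivative along a segment = the force-constant
form `Hess₀`, landed in `PhononSlackCertificatesNearFieldConvexitySegmentSecondVariation`), whence
the second-order Taylor estimate `|φ_u(t) − φ_u(0) − t φ_u′(0)| ≤ 2⁸(14(δ/2)⁻⁶ + 8)‖A‖²‖u‖⁻⁶ t²`
(`hzms_pair_taylor`), and the stress term bound `|V′(‖u‖)/‖u‖ · ⟪u, Au⟫| ≤ (δ⁻⁶ + 1)‖A‖‖u‖⁻⁶`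
(`hzms_abs_stress_le`).  Two pointwise facts of `ReggeStarCoercivityDefectFreeCrystallizesZeroMeanStress`
(`‖y + tMy‖ ≥ ‖y‖/2`, `|V′(r)| ≤ (ρ⁻⁶ + 1)r⁻⁷`) are re-derived here because that file imports
`MuGSC`, whose `UniformlyDiscrete` clashes with `MuGroundStateConfiguration` (imported by
`HullBulkOptimal`, which the stub needs).  All `[folklore]`.
-/

noncomputable section

namespace Summit.AtomisticToContinuum.Crystallization.Theorems.AlphabetGoodHullElementCensusLiouville

open scoped BigOperators RealInnerProductSpace Topology
open Filter Set Metric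
open Literature.MathematicalPhysics.StatisticalMechanics
open Summit.AtomisticToContinuum.Crystallization.Theorems.PhononStabilityNegative
  (Hess₀ deriv_lennardJones deriv_deriv_lennardJones abs_Hess₀_le)
open Summit.AtomisticToContinuum.Crystallization.Theorems.PhononSlackNearFieldConvexity
  (hasDerivAt_lj_along hasDerivAt_lj_along_deriv)

open Summit.AtomisticToContinuum.Crystallization.Theorems.CoarseGrains.Negative.PredicateAPI (E3)

/-! ## An abstract second-order Taylor estimate -/

/-- **Second-order Taylor estimate from a bound on the second derivative.** If `φ′ = φ₁`,
`φ₁′ = φ₂` and `|φ₂| ≤ m` on `|s| ≤ t₀`, then `|φ(t) − φ(0) − t φ₁(0)| ≤ m t²` for `|t| ≤ t₀`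
(mean value theorem twice: `φ₁` is `m`-Lipschitz on the segment `[0, t]`, then
`s ↦ φ(s) − s φ₁(0)` has derivative `φ₁(s) − φ₁(0)`, of size `≤ m|t|`). [folklore] -/
theorem hzms_taylor_abstract {φ φ₁ φ₂ : ℝ → ℝ} {m t₀ : ℝ}
    (h1 : ∀ s : ℝ, |s| ≤ t₀ → HasDerivAt φ (φ₁ s) s)
    (h2 : ∀ s : ℝ, |s| ≤ t₀ → HasDerivAt φ₁ (φ₂ s) s)
    (hb : ∀ s : ℝ, |s| ≤ t₀ → |φ₂ s| ≤ m) {t : ℝ} (ht : |t| ≤ t₀) :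
    |φ t - φ 0 - t * φ₁ 0| ≤ m * t ^ 2 := by
  have hI : ∀ s ∈ Set.uIcc (0 : ℝ) t, |s| ≤ |t| := fun s hs => by
    rcases le_total 0 t with h0t | ht0
    · rw [Set.uIcc_of_le h0t] at hs
      rw [abs_of_nonneg hs.1, abs_of_nonneg h0t]
      exact hs.2
    · rw [Set.uIcc_of_ge ht0] at hs
      rw [abs_of_nonpos hs.2, abs_of_nonpos ht0]
      linarith [hs.1]
  have hIt₀ : ∀ s ∈ Set.uIcc (0 : ℝ) t, |s| ≤ t₀ := fun s hs => (hI s hs).trans ht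
  have h0mem : (0 : ℝ) ∈ Set.uIcc (0 : ℝ) t := Set.left_mem_uIcc
  have htmem : t ∈ Set.uIcc (0 : ℝ) t := Set.right_mem_uIcc
  have hm0 : 0 ≤ m := (abs_nonneg _).trans (hb 0 (by rw [abs_zero]; exact (abs_nonneg t).trans ht))
  -- step 1: `φ₁` is `m`-Lipschitz on the segment
  have step1 : ∀ s ∈ Set.uIcc (0 : ℝ) t, |φ₁ s - φ₁ 0| ≤ m * |t| := by
    intro s hs
    have h := (convex_uIcc (0 : ℝ) t).norm_image_sub_le_of_norm_hasDerivWithin_le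
      (f := φ₁) (f' := φ₂) (fun r hr => (h2 r (hIt₀ r hr)).hasDerivWithinAt)
      (fun r hr => by rw [Real.norm_eq_abs]; exact hb r (hIt₀ r hr)) h0mem hs
    rw [Real.norm_eq_abs, Real.norm_eq_abs, sub_zero] at h
    exact h.trans (mul_le_mul_of_nonneg_left (hI s hs) hm0)
  -- step 2: the corrected function `s ↦ φ s - s φ₁ 0`
  have step2 := (convex_uIcc (0 : ℝ) t).norm_image_sub_le_of_norm_hasDerivWithin_le
      (f := fun s : ℝ => φ s - s * φ₁ 0) (f' := fun s : ℝ => φ₁ s - φ₁ 0) (C := m * |t|)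
      (fun r hr => ((h1 r (hIt₀ r hr)).sub (hasDerivAt_mul_const (φ₁ 0))).hasDerivWithinAt)
      (fun r hr => by rw [Real.norm_eq_abs]; exact step1 r hr) h0mem htmem
  rw [Real.norm_eq_abs, Real.norm_eq_abs, sub_zero] at step2
  have he : φ t - t * φ₁ 0 - (φ 0 - 0 * φ₁ 0) = φ t - φ 0 - t * φ₁ 0 := by ring
  rw [he] at step2
  calc |φ t - φ 0 - t * φ₁ 0| ≤ m * |t| * |t| := step2
    _ = m * t ^ 2 := by rw [mul_assoc, abs_mul_abs_self]; ring

/-! ## Two pointwise facts -/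

/-- `‖y + tMy‖ ≥ ‖y‖/2` once `|t|·‖M‖ ≤ 1/2`. [folklore] -/
theorem hzms_half_norm_le_norm_affine (M : E3 →L[ℝ] E3) {t : ℝ} (ht : |t| * ‖M‖ ≤ 1 / 2)
    (y : E3) : ‖y‖ / 2 ≤ ‖y + t • M y‖ := by
  -- adapted from `PalmGoodLaw.ZeroMeanStress.half_norm_le_norm_affine`
  have h1 : ‖t • M y‖ ≤ ‖y‖ / 2 := by
    rw [norm_smul, Real.norm_eq_abs]
    calc |t| * ‖M y‖ ≤ |t| * (‖M‖ * ‖y‖) :=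
          mul_le_mul_of_nonneg_left (M.le_opNorm y) (abs_nonneg t)
      _ = (|t| * ‖M‖) * ‖y‖ := by ring
      _ ≤ (1 / 2) * ‖y‖ := mul_le_mul_of_nonneg_right ht (norm_nonneg y)
      _ = ‖y‖ / 2 := by ring
  have h2 : ‖y‖ ≤ ‖y + t • M y‖ + ‖t • M y‖ := by
    have := norm_sub_le (y + t • M y) (t • M y)
    rwa [add_sub_cancel_right] at this
  linarith

/-- `|V′(r)|/r ≤ (ρ⁻⁶ + 1)·r⁻⁸` for `r ≥ ρ > 0` (`V′ = −r⁻¹³ + r⁻⁷`). [folklore] -/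
theorem hzms_abs_deriv_lennardJones_div_le {ρ r : ℝ} (hρ : 0 < ρ) (hr : ρ ≤ r) :
    |deriv lennardJones r| / r ≤ (ρ⁻¹ ^ 6 + 1) * r⁻¹ ^ 8 := by
  -- adapted from `PalmGoodLaw.ZeroMeanStress.abs_deriv_lennardJones_le_inv_pow_seven`
  have hr0 : 0 < r := hρ.trans_le hr
  rw [deriv_lennardJones hr0.ne', div_eq_mul_inv]
  have h0 : 0 ≤ r⁻¹ := inv_nonneg.2 hr0.le
  have h1 : r⁻¹ ≤ ρ⁻¹ := (inv_le_inv₀ hr0 hρ).2 hr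
  have h6 : r⁻¹ ^ 6 ≤ ρ⁻¹ ^ 6 := pow_le_pow_left₀ h0 h1 6
  have h7 : 0 ≤ r⁻¹ ^ 7 := pow_nonneg h0 7
  have e13 : (r⁻¹) ^ 13 = (r⁻¹) ^ 6 * (r⁻¹) ^ 7 := by ring
  have hA : |-(r⁻¹) ^ 13 + (r⁻¹) ^ 7| ≤ (ρ⁻¹ ^ 6 + 1) * r⁻¹ ^ 7 :=
    calc |-(r⁻¹) ^ 13 + (r⁻¹) ^ 7| ≤ |-(r⁻¹) ^ 13| + |(r⁻¹) ^ 7| := abs_add_le _ _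
      _ = (r⁻¹) ^ 6 * (r⁻¹) ^ 7 + (r⁻¹) ^ 7 := by
          rw [abs_neg, abs_of_nonneg (pow_nonneg h0 13), abs_of_nonneg h7, e13]
      _ ≤ ρ⁻¹ ^ 6 * (r⁻¹) ^ 7 + (r⁻¹) ^ 7 := by gcongr
      _ = (ρ⁻¹ ^ 6 + 1) * r⁻¹ ^ 7 := by ring
  calc |-(r⁻¹) ^ 13 + (r⁻¹) ^ 7| * r⁻¹ ≤ (ρ⁻¹ ^ 6 + 1) * r⁻¹ ^ 7 * r⁻¹ :=
        mul_le_mul_of_nonneg_right hA h0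
    _ = (ρ⁻¹ ^ 6 + 1) * r⁻¹ ^ 8 := by ring

/-! ## Lennard-Jones along the affine path `t ↦ u + t A u` -/

/-- `|V″(r)| + |V′(r)|/r ≤ (14 ρ⁻⁶ + 8) r⁻⁸` for `r ≥ ρ > 0`
(`V″ = 13 r⁻¹⁴ − 7 r⁻⁸`, `|V′|/r ≤ (ρ⁻⁶ + 1) r⁻⁸`). [folklore] -/
theorem hzms_abs_deriv2_add_le {ρ r : ℝ} (hρ : 0 < ρ) (hr : ρ ≤ r) :
    |deriv (deriv lennardJones) r| + |deriv lennardJones r| / r ≤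
      (14 * ρ⁻¹ ^ 6 + 8) * r⁻¹ ^ 8 := by
  have hr0 : 0 < r := hρ.trans_le hr
  have hB := hzms_abs_deriv_lennardJones_div_le hρ hr
  rw [deriv_deriv_lennardJones hr0.ne']
  have h0 : 0 ≤ r⁻¹ := inv_nonneg.2 hr0.le
  have h1 : r⁻¹ ≤ ρ⁻¹ := (inv_le_inv₀ hr0 hρ).2 hr
  have h6 : r⁻¹ ^ 6 ≤ ρ⁻¹ ^ 6 := pow_le_pow_left₀ h0 h1 6
  have h8 : 0 ≤ r⁻¹ ^ 8 := pow_nonneg h0 8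
  have h68 : 0 ≤ r⁻¹ ^ 6 * r⁻¹ ^ 8 := mul_nonneg (pow_nonneg h0 6) h8
  have h68' : r⁻¹ ^ 6 * r⁻¹ ^ 8 ≤ ρ⁻¹ ^ 6 * r⁻¹ ^ 8 := mul_le_mul_of_nonneg_right h6 h8
  have hA : |13 * r⁻¹ ^ 14 - 7 * r⁻¹ ^ 8| ≤ (13 * ρ⁻¹ ^ 6 + 7) * r⁻¹ ^ 8 := by
    have e14 : r⁻¹ ^ 14 = r⁻¹ ^ 6 * r⁻¹ ^ 8 := by ring
    rw [e14]
    refine abs_le.2 ⟨?_, ?_⟩ <;> nlinarith [h68, h68', h8]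
  calc |13 * r⁻¹ ^ 14 - 7 * r⁻¹ ^ 8| + |deriv lennardJones r| / r
      ≤ (13 * ρ⁻¹ ^ 6 + 7) * r⁻¹ ^ 8 + (ρ⁻¹ ^ 6 + 1) * r⁻¹ ^ 8 := add_le_add hA hB
    _ = (14 * ρ⁻¹ ^ 6 + 8) * r⁻¹ ^ 8 := by ring

/-- **Second derivative along the affine path.** For `‖u‖ ≥ δ > 0` and `|t| ‖A‖ ≤ 1/2`, the
force-constant form at the deformed bond is `|Hess₀ (u + tAu) (Au)| ≤ 2⁸(14(δ/2)⁻⁶ + 8)‖A‖²‖u‖⁻⁶`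
(`‖u + tAu‖ ≥ ‖u‖/2 ≥ δ/2`, crude bound `abs_Hess₀_le`). [folklore] -/
theorem hzms_abs_Hess₀_affine_le (A : E3 →L[ℝ] E3) {δ : ℝ} (hδ : 0 < δ) {t : ℝ}
    (ht : |t| * ‖A‖ ≤ 1 / 2) {u : E3} (hu : δ ≤ ‖u‖) :
    |Hess₀ (u + t • A u) (A u)| ≤ 2 ^ 8 * (14 * (δ / 2)⁻¹ ^ 6 + 8) * ‖A‖ ^ 2 * ‖u‖⁻¹ ^ 6 := by
  set c := u + t • A u with hc
  have hu0 : 0 < ‖u‖ := hδ.trans_le hu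
  have hhalf : ‖u‖ / 2 ≤ ‖c‖ := hzms_half_norm_le_norm_affine A ht u
  have hc0 : 0 < ‖c‖ := by linarith
  have hρ : δ / 2 ≤ ‖c‖ := by linarith
  have h1 := abs_Hess₀_le c (A u)
  have h2 := hzms_abs_deriv2_add_le (by positivity : (0 : ℝ) < δ / 2) hρ
  have hAu : ‖A u‖ ^ 2 ≤ (‖A‖ * ‖u‖) ^ 2 := pow_le_pow_left₀ (norm_nonneg _) (A.le_opNorm u) 2
  have h3 : ‖c‖⁻¹ ≤ 2 * ‖u‖⁻¹ := by
    rw [← inv_inv (2 : ℝ), ← mul_inv, inv_le_inv₀ hc0 (by positivity)]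
    linarith
  have h4 : ‖c‖⁻¹ ^ 8 ≤ (2 * ‖u‖⁻¹) ^ 8 := pow_le_pow_left₀ (inv_nonneg.2 hc0.le) h3 8
  have h5 : ‖u‖⁻¹ ^ 8 * ‖u‖ ^ 2 = ‖u‖⁻¹ ^ 6 := by
    have h : ‖u‖⁻¹ * ‖u‖ = 1 := inv_mul_cancel₀ hu0.ne'
    calc ‖u‖⁻¹ ^ 8 * ‖u‖ ^ 2 = ‖u‖⁻¹ ^ 6 * (‖u‖⁻¹ * ‖u‖) ^ 2 := by ring
      _ = ‖u‖⁻¹ ^ 6 := by rw [h]; ring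
  have hnn : 0 ≤ |deriv (deriv lennardJones) ‖c‖| + |deriv lennardJones ‖c‖| / ‖c‖ := by
    positivity
  calc |Hess₀ c (A u)|
      ≤ (|deriv (deriv lennardJones) ‖c‖| + |deriv lennardJones ‖c‖| / ‖c‖) * ‖A u‖ ^ 2 := h1
    _ ≤ (14 * (δ / 2)⁻¹ ^ 6 + 8) * ‖c‖⁻¹ ^ 8 * (‖A‖ * ‖u‖) ^ 2 :=
        mul_le_mul h2 hAu (sq_nonneg _) (by positivity)
    _ ≤ (14 * (δ / 2)⁻¹ ^ 6 + 8) * (2 * ‖u‖⁻¹) ^ 8 * (‖A‖ * ‖u‖) ^ 2 := by gcongr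
    _ = 2 ^ 8 * (14 * (δ / 2)⁻¹ ^ 6 + 8) * ‖A‖ ^ 2 * (‖u‖⁻¹ ^ 8 * ‖u‖ ^ 2) := by ring
    _ = 2 ^ 8 * (14 * (δ / 2)⁻¹ ^ 6 + 8) * ‖A‖ ^ 2 * ‖u‖⁻¹ ^ 6 := by rw [h5]

/-- **Pair Taylor estimate.** For `‖u‖ ≥ δ > 0`, `t₀ ‖A‖ ≤ 1/2` and `|t| ≤ t₀`:
`|V(‖u + tAu‖) − V(‖u‖) − t · V′(‖u‖)/‖u‖ · ⟪u, Au⟫| ≤ 2⁸(14(δ/2)⁻⁶ + 8)‖A‖²‖u‖⁻⁶ · t²`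
(the derivatives along the path are `hasDerivAt_lj_along`, `hasDerivAt_lj_along_deriv`).
[folklore] -/
theorem hzms_pair_taylor (A : E3 →L[ℝ] E3) {δ : ℝ} (hδ : 0 < δ) {t₀ : ℝ}
    (ht₀ : t₀ * ‖A‖ ≤ 1 / 2) {u : E3} (hu : δ ≤ ‖u‖) {t : ℝ} (ht : |t| ≤ t₀) :
    |lennardJones ‖u + t • A u‖ - lennardJones ‖u‖ -
        t * (deriv lennardJones ‖u‖ / ‖u‖ * ⟪u, A u⟫)| ≤
      2 ^ 8 * (14 * (δ / 2)⁻¹ ^ 6 + 8) * ‖A‖ ^ 2 * ‖u‖⁻¹ ^ 6 * t ^ 2 := by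
  have hsmall : ∀ s : ℝ, |s| ≤ t₀ → |s| * ‖A‖ ≤ 1 / 2 := fun s hs =>
    (mul_le_mul_of_nonneg_right hs (norm_nonneg A)).trans ht₀
  have hu0 : 0 < ‖u‖ := hδ.trans_le hu
  have hne : ∀ s : ℝ, |s| ≤ t₀ → u + s • A u ≠ 0 := fun s hs h => by
    have hh := hzms_half_norm_le_norm_affine A (hsmall s hs) u
    rw [h, norm_zero] at hh
    linarith
  have key := hzms_taylor_abstract (φ := fun s : ℝ => lennardJones ‖u + s • A u‖)
    (φ₁ := fun s : ℝ => deriv lennardJones ‖u + s • A u‖ / ‖u + s • A u‖ * ⟪u + s • A u, A u⟫)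
    (φ₂ := fun s : ℝ => Hess₀ (u + s • A u) (A u))
    (m := 2 ^ 8 * (14 * (δ / 2)⁻¹ ^ 6 + 8) * ‖A‖ ^ 2 * ‖u‖⁻¹ ^ 6) (t₀ := t₀)
    (fun s hs => hasDerivAt_lj_along u (A u) (hne s hs))
    (fun s hs => hasDerivAt_lj_along_deriv u (A u) (hne s hs))
    (fun s hs => hzms_abs_Hess₀_affine_le A hδ (hsmall s hs) hu) ht
  simpa only [zero_smul, add_zero] using key

/-- **Stress term bound.** For `‖u‖ ≥ δ > 0`:
`|V′(‖u‖)/‖u‖ · ⟪u, Au⟫| ≤ (δ⁻⁶ + 1) ‖A‖ ‖u‖⁻⁶` (`|V′(r)|/r ≤ (δ⁻⁶ + 1) r⁻⁸`, Cauchy–Schwarz).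
[folklore] -/
theorem hzms_abs_stress_le (A : E3 →L[ℝ] E3) {δ : ℝ} (hδ : 0 < δ) {u : E3} (hu : δ ≤ ‖u‖) :
    |deriv lennardJones ‖u‖ / ‖u‖ * ⟪u, A u⟫| ≤ (δ⁻¹ ^ 6 + 1) * ‖A‖ * ‖u‖⁻¹ ^ 6 := by
  have hu0 : 0 < ‖u‖ := hδ.trans_le hu
  have h8 := hzms_abs_deriv_lennardJones_div_le hδ hu
  have hcs : |⟪u, A u⟫| ≤ ‖u‖ * (‖A‖ * ‖u‖) :=
    (abs_real_inner_le_norm _ _).trans (mul_le_mul_of_nonneg_left (A.le_opNorm u) (norm_nonneg _))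
  have h5 : ‖u‖⁻¹ ^ 8 * (‖u‖ * ‖u‖) = ‖u‖⁻¹ ^ 6 := by
    have h : ‖u‖⁻¹ * ‖u‖ = 1 := inv_mul_cancel₀ hu0.ne'
    calc ‖u‖⁻¹ ^ 8 * (‖u‖ * ‖u‖) = ‖u‖⁻¹ ^ 6 * (‖u‖⁻¹ * ‖u‖) ^ 2 := by ring
      _ = ‖u‖⁻¹ ^ 6 := by rw [h]; ring
  rw [abs_mul, abs_div, abs_norm]
  calc |deriv lennardJones ‖u‖| / ‖u‖ * |⟪u, A u⟫|
      ≤ |deriv lennardJones ‖u‖| / ‖u‖ * (‖u‖ * (‖A‖ * ‖u‖)) := by gcongr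
    _ ≤ (δ⁻¹ ^ 6 + 1) * ‖u‖⁻¹ ^ 8 * (‖u‖ * (‖A‖ * ‖u‖)) :=
        mul_le_mul_of_nonneg_right h8 (by positivity)
    _ = (δ⁻¹ ^ 6 + 1) * ‖A‖ * (‖u‖⁻¹ ^ 8 * (‖u‖ * ‖u‖)) := by ring
    _ = (δ⁻¹ ^ 6 + 1) * ‖A‖ * ‖u‖⁻¹ ^ 6 := by rw [h5]

/-- Distances of affinely deformed points: `dist (y + tAy) (z + tAz) = ‖(y − z) + tA(y − z)‖`.
[folklore] -/
theorem hzms_dist_affine (A : E3 →L[ℝ] E3) (t : ℝ) (y z : E3) :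
    dist (y + t • A y) (z + t • A z) = ‖(y - z) + t • A (y - z)‖ := by
  rw [dist_eq_norm, map_sub, smul_sub]
  congr 1
  abel

end Summit.AtomisticToContinuum.Crystallization.Theorems.AlphabetGoodHullElementCensusLiouville

end
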